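import Summits.ResolutionOfSingularities.ResolutionOfSingularities.Theorems.HilbertSamuelEliminationSigmaMaxModificationsCorridor3WLadderSegmentsHEmpStep
import HarnessLib

/-!
# [OURS · L1 W4.2] (H-emp) WITHIN THE UNIT: along a unit based at a blown-up isolated stage, every WAITING step's centre misses the near locus over
# the base, and every GENUINE step's centre contains it — from the label/replay discipline and two geometric inputs consumed by name
# (crux `SigmaMaxModifications` stmt-ResolutionOfSingularities-18506; conjunct `SigmaMaxModificationsCorridor3` stmt-…-19249; line `w_ladder`;
# RECOGNITION (R5) = (H-emp), assembled)

Stub worker res-L1-w42-stub-1 (gen 4). Helper file `--supports stmt-ResolutionOfSingularities-19249 --as helper`; kernel only, FACT-FREE, no new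
definition. Companion of `…SegmentsReplayDiscipline` (p523512: a blown-up isolated step is a whole-part step, `P_{b+1} = none`) and
`…SegmentsNearLabels` (the near locus `N_n` over `x_b` is clopen in the stratum; one label inside it propagates).

THE INVARIANT along the stages `b + n`, `1 ≤ n < M`, of a chain from a maximal origin (functional admissible oracle, `ν ≠ Φ^{(N)}`), for a base
`b` blown up at a marked point isolated in its Hilbert–Samuel locus:
  (one label) all irreducible components of `X_{b+n}(ν)` inside `N_n` carry one label;
  (replay avoidance) every centre still to be replayed lies, under the replay identification, OFF `N_n`.
It holds at `n = 1` (`P_{b+1} = none`; the components inside `N_1` dominate the component `{x_b}`), and propagates (`…NearLabels.oneLabel_succ`;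
`replayAvoid_step`: at a cycle start the oracle's centres lie over the non-regular locus of the treated part `T`, which is REGULAR along `N_n` —
an isolated point of the reduced `T` when `N_n` is finite, and the regular scheme `N_n` itself, an open piece of `T`, when `N_n` is an infinite
irreducible set (`isRegularLocalRing_stalk_subscheme_of_locally_eq`); inside a cycle the remaining centres are read one blow-up higher).
CONSEQUENCE (`centre_inter_nearLocus_eq_empty_of_not_isBlownUp`, `nearLocus_subset_centre_of_isBlownUp`, `locTower_C_eq_empty_of_lt`): for
`n < M`, a canonical centre meeting `N_n` contains `N_n ∋ x_{b+n}` (whole-part steps by one label; replay steps never meet it), so WAITING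
steps have centres disjoint from `N_n` — the localised centre `(locTower b).C n` is EMPTY — and GENUINE steps have `N_n ⊆ C_{b+n}` (CJS
Def. 6.38 (iii) up to the identification of the localised centre with the near locus).

THE TWO GEOMETRIC INPUTS (hypotheses, for `0 < n < M`; recognition geometry of res-L1-w42-stub-2 / res-D-pv-038, CJS Lemma 6.33 / Def. 6.34 /
p. 105 «`C_q ≅ ℙ¹_{k(x)}` … finitely many closed points»):
  (Dich) `N_n` is an infinite irreducible set, or a finite set of closed points;
  (RegN) if `N_n` is infinite, the reduced closed subscheme on `N_n` is regular.
`M` is a free parameter (the consumer takes `M` = the relative index of the next blown-up isolated stage, i.e. the unit based at `b`).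

OURS bookkeeping; NOT a statement of the manuscript [Hironaka2017] nor of [CossartJannsenSaito2020]. AI-written; AI review is weaker than expert
review.

References: V. Cossart, U. Jannsen, S. Saito, LNM 2270 (2020), Rem. 6.29 (1), Lemma 6.33, Def. 6.34, Def. 6.38, p. 105, p. 107
[CossartJannsenSaito2020].
-/

noncomputable section

set_option linter.dupNamespace false -- namespace `…Corridor3.Moving` re-enters `…Corridor3` (module convention of the Moving files)

open CategoryTheory AlgebraicGeometry TopologicalSpace Topology IsLocalRing
open Literature.AlgebraicGeometry.Resolution Literature.RingTheory.HilbertSamuel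
open Literature.AlgebraicGeometry.CossartJannsenSaito2020
open Summit.ResolutionOfSingularities.ResolutionOfSingularities.Theorems.CampaignW42
open Summit.ResolutionOfSingularities.ResolutionOfSingularities.Theorems.SigmaMaxModificationsCorridor3.Helpers

namespace Summit.ResolutionOfSingularities.ResolutionOfSingularities.Theorems.SigmaMaxModificationsCorridor3.Moving.Seg

/-! ## §3. Along the unit: the invariant, and (H-emp) -/

section Chain

variable {R : ∀ S : Scheme.{0}, CentreSeq S → Prop} {N : ℕ} {ν : ℕ → ℕ} {k : Type} [Field k]
  {c : ℕ → MarkedStage.{0}} (hc : ∀ n, CanonicalNearStep R N ν (c n) (c (n + 1))) (hRf : OracleFunctional R) (hRa : OracleAdmissible R)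
  (hν : ν ≠ iterPSum N Phi) (h0 : Helpers.CycleInv k N ν (c 0))
  {p : ℕ} {X : Scheme.{0}} [IsLocallyNoetherian X] {x : X} (hX : IsMaximalOrigin p N ν X x)
  (hreach : Reaches R N ν (MarkedStage.init X x) (c 0))

include hX hreach in
/-- **THE TREATED PART IS REGULAR ALONG THE NEAR LOCUS** (one label at the stage; (Dich) and (RegN) at the stage): for every label part
`Y^{(j)}` with its reduced structure `T`, `T` is regular at each of its points lying in `N_n`. (Finite `N_n`: such a point is isolated in `T`,
regular since `T` is reduced. Infinite irreducible `N_n`: `N_n ⊆ Y^{(j)}` by one label, `N_n = Y^{(j)} ∩ φ_n⁻¹(U)` is an open piece of `T` on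
which `T` is the regular reduced scheme `N_n`.) [cite: CossartJannsenSaito2020, Rem. 6.29 (1), Def. 6.38 (iii)] -/
theorem part_regular_along_nearLocus (b : ℕ)
    (hU : ∃ U : Set (c b).W, IsOpen U ∧ (c b).pt ∈ U ∧ U ∩ Scheme.hsStratum (c b).W N ν ⊆ {(c b).pt}) (n : ℕ)
    (hone : ∀ Z₁ ∈ componentsIn (Scheme.hsStratum (c (b + n)).W N ν), ∀ Z₂ ∈ componentsIn (Scheme.hsStratum (c (b + n)).W N ν),
      Z₁ ⊆ (upTower hc hRa hν h0 b).nearLocus N (c b).pt n → Z₂ ⊆ (upTower hc hRa hν h0 b).nearLocus N (c b).pt n →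
        (c (b + n)).L.label Z₁ = (c (b + n)).L.label Z₂)
    (hDich : (((upTower hc hRa hν h0 b).nearLocus N (c b).pt n).Infinite ∧ IsIrreducible ((upTower hc hRa hν h0 b).nearLocus N (c b).pt n)) ∨
      (((upTower hc hRa hν h0 b).nearLocus N (c b).pt n).Finite ∧
        ∀ y ∈ (upTower hc hRa hν h0 b).nearLocus N (c b).pt n, IsClosed ({y} : Set (c (b + n)).W)))
    (hReg : ((upTower hc hRa hν h0 b).nearLocus N (c b).pt n).Infinite →
      ∀ h : IsClosed ((upTower hc hRa hν h0 b).nearLocus N (c b).pt n),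
        Scheme.IsRegular (Scheme.IdealSheafData.vanishingIdeal ⟨(upTower hc hRa hν h0 b).nearLocus N (c b).pt n, h⟩).subscheme)
    (j : ℕ) (h : IsClosed ((c (b + n)).L.part (Scheme.hsStratum (c (b + n)).W N ν) j))
    (z : ↥(Scheme.IdealSheafData.vanishingIdeal ⟨(c (b + n)).L.part (Scheme.hsStratum (c (b + n)).W N ν) j, h⟩).subscheme)
    (hz : (Scheme.IdealSheafData.vanishingIdeal ⟨(c (b + n)).L.part (Scheme.hsStratum (c (b + n)).W N ν) j, h⟩).subschemeι.base z ∈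
      (upTower hc hRa hν h0 b).nearLocus N (c b).pt n) :
    z ∈ Scheme.regularLocus (Scheme.IdealSheafData.vanishingIdeal ⟨(c (b + n)).L.part (Scheme.hsStratum (c (b + n)).W N ν) j, h⟩).subscheme := by
  haveI : IsReduced (Scheme.IdealSheafData.vanishingIdeal ⟨_, h⟩).subscheme := ComponentGluing.isReduced_subscheme_vanishingIdeal _
  have hrangeT : Set.range (Scheme.IdealSheafData.vanishingIdeal ⟨_, h⟩).subschemeι.base =
      (c (b + n)).L.part (Scheme.hsStratum (c (b + n)).W N ν) j := by
    rw [Scheme.IdealSheafData.range_subschemeι, Scheme.IdealSheafData.coe_support_vanishingIdeal]; rfl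
  have hmemP : ∀ w : ↥(Scheme.IdealSheafData.vanishingIdeal ⟨_, h⟩).subscheme,
      (Scheme.IdealSheafData.vanishingIdeal ⟨_, h⟩).subschemeι.base w ∈ (c (b + n)).L.part (Scheme.hsStratum (c (b + n)).W N ν) j := by
    intro w
    have hw := Set.mem_range_self (f := (Scheme.IdealSheafData.vanishingIdeal ⟨_, h⟩).subschemeι.base) w
    rw [hrangeT] at hw
    exact hw
  have hyP := hmemP z
  have hNP : (upTower hc hRa hν h0 b).nearLocus N (c b).pt n ⊆ (c (b + n)).L.part (Scheme.hsStratum (c (b + n)).W N ν) j :=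
    nearLocus_subset_part_of_meets hc hRa hν h0 hX hreach b hU n hone ⟨_, hyP, hz⟩
  obtain ⟨U, hUo, hbU, hUiso⟩ := hU
  rcases hDich with ⟨hinf, -⟩ | ⟨hfin, hcl⟩
  · -- infinite irreducible: transfer regularity from the reduced scheme `N_n` along the open `φ_n⁻¹(U)`
    have hO : IsOpen (((upTower hc hRa hν h0 b).phi n).base ⁻¹' U) := hUo.preimage ((upTower hc hRa hν h0 b).phi n).continuous
    have hNO : (upTower hc hRa hν h0 b).nearLocus N (c b).pt n ⊆ ((upTower hc hRa hν h0 b).phi n).base ⁻¹' U := fun w hw => by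
      rw [Set.mem_preimage, hw.1]; exact hbU
    have hAB : ((⟨(upTower hc hRa hν h0 b).nearLocus N (c b).pt n, isClosed_nearLocus hc hRa hν h0 hX hreach b n⟩ : Closeds (c (b + n)).W) :
          Set (c (b + n)).W) ∩ ((upTower hc hRa hν h0 b).phi n).base ⁻¹' U =
        ((⟨(c (b + n)).L.part (Scheme.hsStratum (c (b + n)).W N ν) j, h⟩ : Closeds (c (b + n)).W) : Set (c (b + n)).W) ∩
          ((upTower hc hRa hν h0 b).phi n).base ⁻¹' U := by
      show (upTower hc hRa hν h0 b).nearLocus N (c b).pt n ∩ _ = (c (b + n)).L.part (Scheme.hsStratum (c (b + n)).W N ν) j ∩ _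
      apply Set.Subset.antisymm
      · exact Set.inter_subset_inter_left _ hNP
      · rintro w ⟨hwP, hwU⟩
        refine ⟨?_, hwU⟩
        rw [nearLocus_eq_hsStratum_inter_preimage hc hRa hν h0 hX hreach b hbU hUiso n]
        exact ⟨(c (b + n)).L.part_subset _ _ hwP, hwU⟩
    exact isRegularLocalRing_stalk_subscheme_of_locally_eq _ _ hO hAB (hReg hinf _) z (hNO hz)
  · -- finite closed: `z` is an isolated point of the reduced scheme `T`
    obtain ⟨O, hOo, hOY⟩ := exists_isOpen_inter_hsStratum_eq_singleton hc hRa hν h0 hX hreach b ⟨U, hUo, hbU, hUiso⟩ n hfin hcl hz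
    refine mem_regularLocus_of_isOpen_singleton ?_
    have hzO : (Scheme.IdealSheafData.vanishingIdeal ⟨_, h⟩).subschemeι.base z ∈ O := by
      have : (Scheme.IdealSheafData.vanishingIdeal ⟨_, h⟩).subschemeι.base z ∈ O ∩ Scheme.hsStratum (c (b + n)).W N ν := by
        rw [hOY]; exact Set.mem_singleton _
      exact this.1
    have heq : ({z} : Set ↥(Scheme.IdealSheafData.vanishingIdeal ⟨_, h⟩).subscheme) =
        (Scheme.IdealSheafData.vanishingIdeal ⟨_, h⟩).subschemeι.base ⁻¹' O := by
      ext w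
      simp only [Set.mem_singleton_iff, Set.mem_preimage]
      constructor
      · intro hwz; rw [hwz]; exact hzO
      · intro hw
        have hw' : (Scheme.IdealSheafData.vanishingIdeal ⟨_, h⟩).subschemeι.base w ∈ O ∩ Scheme.hsStratum (c (b + n)).W N ν :=
          ⟨hw, (c (b + n)).L.part_subset _ _ (hmemP w)⟩
        rw [hOY] at hw'
        exact (Scheme.IdealSheafData.vanishingIdeal ⟨_, h⟩).subschemeι.isEmbedding.injective hw'
    rw [heq]
    exact hOo.preimage (Scheme.IdealSheafData.vanishingIdeal ⟨_, h⟩).subschemeι.base.hom.continuous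

include hX hreach in
/-- The near locus at the base is `{x_b}`; the dichotomy there (finite closed) and one label there. [folklore] -/
theorem nearLocus_base (b : ℕ) :
    (upTower hc hRa hν h0 b).nearLocus N (c b).pt 0 = {(c b).pt} ∧
    ((((upTower hc hRa hν h0 b).nearLocus N (c b).pt 0).Infinite ∧ IsIrreducible ((upTower hc hRa hν h0 b).nearLocus N (c b).pt 0)) ∨
      (((upTower hc hRa hν h0 b).nearLocus N (c b).pt 0).Finite ∧
        ∀ y ∈ (upTower hc hRa hν h0 b).nearLocus N (c b).pt 0, IsClosed ({y} : Set (c (b + 0)).W))) ∧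
    (∀ Z₁ ∈ componentsIn (Scheme.hsStratum (c (b + 0)).W N ν), ∀ Z₂ ∈ componentsIn (Scheme.hsStratum (c (b + 0)).W N ν),
      Z₁ ⊆ (upTower hc hRa hν h0 b).nearLocus N (c b).pt 0 → Z₂ ⊆ (upTower hc hRa hν h0 b).nearLocus N (c b).pt 0 →
        (c (b + 0)).L.label Z₁ = (c (b + 0)).L.label Z₂) := by
  have hN0 : (upTower hc hRa hν h0 b).nearLocus N (c b).pt 0 = {(c b).pt} := BlowupTower.nearLocus_zero _ N _
  have hclosed : IsClosed ({(c b).pt} : Set (c b).W) := Reaches.isClosed_pt hX.isClosed (reaches_chain hreach hc b)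
  refine ⟨hN0, Or.inr ⟨?_, fun y hy => ?_⟩, fun Z₁ hZ₁ Z₂ hZ₂ h₁ h₂ => ?_⟩
  · rw [hN0]; exact Set.finite_singleton _
  · rw [hN0] at hy
    have hy' : y = (c b).pt := hy
    subst hy'
    exact hclosed
  · rw [hN0] at h₁ h₂
    rw [(componentsIn.nonempty hZ₁).subset_singleton_iff.mp h₁, (componentsIn.nonempty hZ₂).subset_singleton_iff.mp h₂]

include hRf hX hreach in
/-- **THE INVARIANT ALONG THE UNIT.** For a base `b` blown up at a marked point isolated in the Hilbert–Samuel locus, and `M` such that (Dich) and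
(RegN) hold at the stages `0 < n < M`: at every stage `0 < n < M`, ONE LABEL inside `N_n` and REPLAY AVOIDANCE off `N_n` hold.
[cite: CossartJannsenSaito2020, Rem. 6.29 (1), Def. 6.38] -/
theorem oneLabel_and_replayAvoid (b : ℕ) (hb : (c b).IsBlownUp R N ν) (hiso : Iso N (c b)) (M : ℕ)
    (hDich : ∀ n, 0 < n → n < M →
      (((upTower hc hRa hν h0 b).nearLocus N (c b).pt n).Infinite ∧ IsIrreducible ((upTower hc hRa hν h0 b).nearLocus N (c b).pt n)) ∨
      (((upTower hc hRa hν h0 b).nearLocus N (c b).pt n).Finite ∧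
        ∀ y ∈ (upTower hc hRa hν h0 b).nearLocus N (c b).pt n, IsClosed ({y} : Set (c (b + n)).W)))
    (hReg : ∀ n, 0 < n → n < M → ((upTower hc hRa hν h0 b).nearLocus N (c b).pt n).Infinite →
      ∀ h : IsClosed ((upTower hc hRa hν h0 b).nearLocus N (c b).pt n),
        Scheme.IsRegular (Scheme.IdealSheafData.vanishingIdeal ⟨(upTower hc hRa hν h0 b).nearLocus N (c b).pt n, h⟩).subscheme) :
    ∀ n, 0 < n → n < M →
      (∀ Z₁ ∈ componentsIn (Scheme.hsStratum (c (b + n)).W N ν), ∀ Z₂ ∈ componentsIn (Scheme.hsStratum (c (b + n)).W N ν),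
        Z₁ ⊆ (upTower hc hRa hν h0 b).nearLocus N (c b).pt n → Z₂ ⊆ (upTower hc hRa hν h0 b).nearLocus N (c b).pt n →
          (c (b + n)).L.label Z₁ = (c (b + n)).L.label Z₂) ∧
      ∀ Q, (c (b + n)).P = some Q → Q.rest.CentresOver (Q.hom.base ⁻¹' ((upTower hc hRa hν h0 b).nearLocus N (c b).pt n)ᶜ) := by
  obtain ⟨k', _, _, hg⟩ := hX.exists_stateGood_of_reaches hRa hν (reaches_chain hreach hc b)
  have hU := stratumIsolated_of_iso hg hiso
  obtain ⟨hN0, hD0, hone0⟩ := nearLocus_base hc hRa hν h0 hX hreach b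
  intro n
  induction n with
  | zero => intro h; exact absurd h (lt_irrefl 0)
  | succ n ih =>
    intro _ hlt
    rcases Nat.eq_zero_or_pos n with rfl | hpos
    · -- `n + 1 = 1`: one label from the base; replay avoidance vacuous (`P_{b+1} = none`)
      refine ⟨oneLabel_succ hc hRa hν h0 hX hreach b hU 0 hD0 (hDich _ Nat.one_pos hlt) hone0, fun Q hQ => ?_⟩
      have hnone : (c (b + 1)).P = none := P_succ_eq_none_of_isBlownUp_of_iso hc hRf hRa hν hX hreach b hb hiso
      exact absurd (hnone.symm.trans hQ) (by simp)
    · obtain ⟨hone, hRA⟩ := ih hpos (Nat.lt_of_succ_lt hlt)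
      have hDn := hDich n hpos (Nat.lt_of_succ_lt hlt)
      refine ⟨oneLabel_succ hc hRa hν h0 hX hreach b hU n hDn (hDich _ (Nat.succ_pos n) hlt) hone, ?_⟩
      have hf : StepProjection R N ν (c (b + n)) (c (b + (n + 1))) ((upTower hc hRa hν h0 b).π n) :=
        Helpers.stepProjection_chainProj (shiftStep hc b) n
      exact replayAvoid_step hRa hf (image_nearLocus_succ_subset hc hRa hν h0 b n) hRA
        fun _ j h _ z hz => part_regular_along_nearLocus hc hRa hν h0 hX hreach b hU n hone hDn (hReg n hpos (Nat.lt_of_succ_lt hlt)) j h z hz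

include hRf hX hreach in
/-- **A CANONICAL CENTRE MEETING THE NEAR LOCUS CONTAINS IT** (stages `n < M` of the unit). [cite: CossartJannsenSaito2020, Def. 6.38 (iii)] -/
theorem nearLocus_subset_centre_of_meets (b : ℕ) (hb : (c b).IsBlownUp R N ν) (hiso : Iso N (c b)) (M : ℕ)
    (hDich : ∀ n, 0 < n → n < M →
      (((upTower hc hRa hν h0 b).nearLocus N (c b).pt n).Infinite ∧ IsIrreducible ((upTower hc hRa hν h0 b).nearLocus N (c b).pt n)) ∨
      (((upTower hc hRa hν h0 b).nearLocus N (c b).pt n).Finite ∧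
        ∀ y ∈ (upTower hc hRa hν h0 b).nearLocus N (c b).pt n, IsClosed ({y} : Set (c (b + n)).W)))
    (hReg : ∀ n, 0 < n → n < M → ((upTower hc hRa hν h0 b).nearLocus N (c b).pt n).Infinite →
      ∀ h : IsClosed ((upTower hc hRa hν h0 b).nearLocus N (c b).pt n),
        Scheme.IsRegular (Scheme.IdealSheafData.vanishingIdeal ⟨(upTower hc hRa hν h0 b).nearLocus N (c b).pt n, h⟩).subscheme)
    (n : ℕ) (hn : n < M) {C : (c (b + n)).W.IdealSheafData} {P' : Option (Pending (blowup C))}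
    (hcs : IsCanonicalStep R N ν (c (b + n)).L (c (b + n)).P C P')
    (hmeet : ((C.support : Set (c (b + n)).W) ∩ (upTower hc hRa hν h0 b).nearLocus N (c b).pt n).Nonempty) :
    (upTower hc hRa hν h0 b).nearLocus N (c b).pt n ⊆ (C.support : Set (c (b + n)).W) := by
  obtain ⟨k', _, _, hg⟩ := hX.exists_stateGood_of_reaches hRa hν (reaches_chain hreach hc b)
  have hU := stratumIsolated_of_iso hg hiso
  rcases Nat.eq_zero_or_pos n with rfl | hpos
  · -- at the base the centre is THE genuine centre, and `N_0 = {x_b}`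
    obtain ⟨C₁, P₁, hcs₁, hx₁⟩ := hb
    obtain rfl : C₁ = C := hcs₁.centre_unique hRf hcs
    rw [(nearLocus_base hc hRa hν h0 hX hreach b).1]
    exact Set.singleton_subset_iff.mpr hx₁
  · obtain ⟨hone, hRA⟩ := oneLabel_and_replayAvoid hc hRf hRa hν h0 hX hreach b hb hiso M hDich hReg n hpos hn
    obtain ⟨ℓ, hℓ⟩ := exists_part_of_centre_meets hRa hRA
      (fun _ j h _ z hz => part_regular_along_nearLocus hc hRa hν h0 hX hreach b hU n hone (hDich n hpos hn) (hReg n hpos hn) j h z hz)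
      hcs hmeet
    rw [hℓ] at hmeet ⊢
    exact nearLocus_subset_part_of_meets hc hRa hν h0 hX hreach b hU n hone hmeet

include hRf hX hreach in
/-- **(H-emp), STEP FORM: A WAITING STEP'S CENTRE MISSES THE NEAR LOCUS** (stages `n < M` of the unit). [cite: CossartJannsenSaito2020, Def. 6.38 (iii), Rem. 6.29 (1)] -/
theorem centre_inter_nearLocus_eq_empty_of_not_isBlownUp (b : ℕ) (hb : (c b).IsBlownUp R N ν) (hiso : Iso N (c b)) (M : ℕ)
    (hDich : ∀ n, 0 < n → n < M →
      (((upTower hc hRa hν h0 b).nearLocus N (c b).pt n).Infinite ∧ IsIrreducible ((upTower hc hRa hν h0 b).nearLocus N (c b).pt n)) ∨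
      (((upTower hc hRa hν h0 b).nearLocus N (c b).pt n).Finite ∧
        ∀ y ∈ (upTower hc hRa hν h0 b).nearLocus N (c b).pt n, IsClosed ({y} : Set (c (b + n)).W)))
    (hReg : ∀ n, 0 < n → n < M → ((upTower hc hRa hν h0 b).nearLocus N (c b).pt n).Infinite →
      ∀ h : IsClosed ((upTower hc hRa hν h0 b).nearLocus N (c b).pt n),
        Scheme.IsRegular (Scheme.IdealSheafData.vanishingIdeal ⟨(upTower hc hRa hν h0 b).nearLocus N (c b).pt n, h⟩).subscheme)
    (n : ℕ) (hn : n < M) (hw : ¬ (c (b + n)).IsBlownUp R N ν) {C : (c (b + n)).W.IdealSheafData} {P' : Option (Pending (blowup C))}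
    (hcs : IsCanonicalStep R N ν (c (b + n)).L (c (b + n)).P C P') :
    (C.support : Set (c (b + n)).W) ∩ (upTower hc hRa hν h0 b).nearLocus N (c b).pt n = ∅ := by
  by_contra hne
  have hsub := nearLocus_subset_centre_of_meets hc hRf hRa hν h0 hX hreach b hb hiso M hDich hReg n hn hcs (Set.nonempty_iff_ne_empty.mpr hne)
  exact hw ⟨C, P', hcs, hsub (pt_mem_nearLocus hc hRa hν h0 hX hreach b n)⟩

include hRf hX hreach in
/-- **GENUINE STEPS OF THE UNIT CONTAIN THE NEAR LOCUS**: `N_n ⊆ C_{b+n}` when `x_{b+n}` is blown up (`n < M`) — CJS Def. 6.38 (iii)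
`C_q = φ_q⁻¹(x) ∩ X_q(ν)` up to the identification of the localised centre. [cite: CossartJannsenSaito2020, Def. 6.38 (iii)] -/
theorem nearLocus_subset_centre_of_isBlownUp (b : ℕ) (hb : (c b).IsBlownUp R N ν) (hiso : Iso N (c b)) (M : ℕ)
    (hDich : ∀ n, 0 < n → n < M →
      (((upTower hc hRa hν h0 b).nearLocus N (c b).pt n).Infinite ∧ IsIrreducible ((upTower hc hRa hν h0 b).nearLocus N (c b).pt n)) ∨
      (((upTower hc hRa hν h0 b).nearLocus N (c b).pt n).Finite ∧
        ∀ y ∈ (upTower hc hRa hν h0 b).nearLocus N (c b).pt n, IsClosed ({y} : Set (c (b + n)).W)))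
    (hReg : ∀ n, 0 < n → n < M → ((upTower hc hRa hν h0 b).nearLocus N (c b).pt n).Infinite →
      ∀ h : IsClosed ((upTower hc hRa hν h0 b).nearLocus N (c b).pt n),
        Scheme.IsRegular (Scheme.IdealSheafData.vanishingIdeal ⟨(upTower hc hRa hν h0 b).nearLocus N (c b).pt n, h⟩).subscheme)
    (n : ℕ) (hn : n < M) (hg : (c (b + n)).IsBlownUp R N ν) :
    (upTower hc hRa hν h0 b).nearLocus N (c b).pt n ⊆ (upTower hc hRa hν h0 b).C n := by
  obtain ⟨P', hcs⟩ := Helpers.isCanonicalStep_chainCentre (shiftStep hc b) n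
  obtain ⟨C₁, P₁, hcs₁, hx₁⟩ := hg
  obtain rfl : C₁ = Helpers.chainCentre (shiftStep hc b) n := hcs₁.centre_unique hRf hcs
  exact nearLocus_subset_centre_of_meets hc hRf hRa hν h0 hX hreach b hb hiso M hDich hReg n hn hcs
    ⟨_, hx₁, pt_mem_nearLocus hc hRa hν h0 hX hreach b n⟩

include hRf hX hreach in
/-- **(H-emp) WITHIN THE UNIT: THE LOCALISED CENTRE OF A WAITING STEP IS EMPTY** — `(locTower b).C n = ∅` for every `n < M` at which
`x_{b+n}` is not blown up (by `Seg.locTower_C_eq_empty_iff`). With `M` = the relative index of the next blown-up isolated stage this is the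
recognition hypothesis (H-emp) of the units-half extraction, restricted (correctly) to the unit based at `b`.
[cite: CossartJannsenSaito2020, Def. 6.38 (iii), Rem. 6.29 (1), p. 107] -/
theorem locTower_C_eq_empty_of_lt (b : ℕ) (hb : (c b).IsBlownUp R N ν) (hiso : Iso N (c b)) (M : ℕ)
    (hDich : ∀ n, 0 < n → n < M →
      (((upTower hc hRa hν h0 b).nearLocus N (c b).pt n).Infinite ∧ IsIrreducible ((upTower hc hRa hν h0 b).nearLocus N (c b).pt n)) ∨
      (((upTower hc hRa hν h0 b).nearLocus N (c b).pt n).Finite ∧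
        ∀ y ∈ (upTower hc hRa hν h0 b).nearLocus N (c b).pt n, IsClosed ({y} : Set (c (b + n)).W)))
    (hReg : ∀ n, 0 < n → n < M → ((upTower hc hRa hν h0 b).nearLocus N (c b).pt n).Infinite →
      ∀ h : IsClosed ((upTower hc hRa hν h0 b).nearLocus N (c b).pt n),
        Scheme.IsRegular (Scheme.IdealSheafData.vanishingIdeal ⟨(upTower hc hRa hν h0 b).nearLocus N (c b).pt n, h⟩).subscheme)
    (n : ℕ) (hn : n < M) (hw : ¬ (c (b + n)).IsBlownUp R N ν) : (locTower hc hRa hν h0 b).C n = ∅ := by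
  obtain ⟨k', _, _, hg⟩ := hX.exists_stateGood_of_reaches hRa hν (reaches_chain hreach hc b)
  have hU := stratumIsolated_of_iso hg hiso
  obtain ⟨P', hcs⟩ := Helpers.isCanonicalStep_chainCentre (shiftStep hc b) n
  exact (locTower_C_eq_empty_iff hc hRa hν h0 hX hreach b hU n).mpr
    (centre_inter_nearLocus_eq_empty_of_not_isBlownUp hc hRf hRa hν h0 hX hreach b hb hiso M hDich hReg n hn hw hcs)

end Chain

end Summit.ResolutionOfSingularities.ResolutionOfSingularities.Theorems.SigmaMaxModificationsCorridor3.Moving.Seg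

end
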